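import Summits.ValiantsHypothesis.ValiantsHypothesis.Theorems.KPlusLogSqLawTropicalPermutationChanges

/-!
# Route «KPlusLogSqLaw» — structure lemma: class switches are bounded by the SUPPORT, not by `m²`

HONEST FRAMING.  Helper file (`--supports stmt-ValiantsHypothesis-19561`) refining the tree's permutation budget
`TropicalCensus.card_samePerm_steps_le` / `le_permChanges_add` (`…TropicalPermutationChanges`, val-sym-lift-p2): along a dominant
chain of pairwise distinct terms at strictly increasing slopes, the steps that KEEP the permutation number at most
`#{present (entry, class) pairs of positive exponent rank}` ≤ `#{present entries} · (K − 1)` (instead of `m²·(K−1)`), hence for a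
design supported in a two-sided band `|a − i| ≤ B` at most `(2B+1)·m·(K−1)`.  So in a BANDED design every chain longer than
`O(B·m·K)` is made of PERMUTATION changes — the kernel form of the «carrier lemma» of the cell's K = 4 digest
(HOME/val-sym-lift-p1/g7/K4-JOINT-OBSTRUCTION-DIGEST.md §3b, seat val-sym-lift-p1 g7, 2026-08-27): a banded two-digit family whose
z-blocks each keep one permutation has at most `(K−1)·(2B+1)·m + #blocks` terms.  STRUCTURAL INEQUALITIES ONLY: nothing is asserted
about `TropicalB`, `WeakLifting`, `Lifting`, `KPlusLogSqLaw`, `MatrixDescartes` (stmt-ValiantsHypothesis-18050) or VP ≠ VNP.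
[folklore] (the injection `k ↦ (entry, new class)` of `card_samePerm_steps_le`, with its range read off).
-/

set_option linter.dupNamespace false
set_option autoImplicit false

namespace Summit.ValiantsHypothesis.ValiantsHypothesis.Theorems.LacunarySymmetroidMatrixDescartes.TropicalCensus

open Summit.ValiantsHypothesis.ValiantsHypothesis.Theorems.MatrixDescartes.Negative
open scoped BigOperators
open Finset

section PermChangesSupport

variable {m K : ℕ}

/-- **Same-permutation steps ≤ present (entry, class) pairs of positive rank.**  Along a dominant chain of pairwise distinct
terms at strictly increasing slopes, `k ↦ ((σₖ₊₁ i, i), λₖ₊₁ i)` (at a position `i` where the class changes) is an injection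
from the permutation-keeping steps into the present entry–class pairs `(a, i, l)` (`ε a i l ≠ 0`) with `dRank d l ≥ 1`. [folklore] -/
theorem card_samePerm_steps_le_card_presentClasses (d : Fin K → ℕ) (v ε : Fin m → Fin m → Fin K → ℤ) (n : ℕ)
    (θ : Fin (n + 1) → ℤ) (p : Fin (n + 1) → Equiv.Perm (Fin m) × (Fin m → Fin K)) (hθ : StrictMono θ)
    (hdom : ∀ k, IsDominant d v ε (θ k) (p k)) (hinj : Function.Injective p) :
    (univ.filter fun k : Fin n => (p k.castSucc).1 = (p k.succ).1).card ≤
      (univ.filter fun t : (Fin m × Fin m) × Fin K => ε t.1.1 t.1.2 t.2 ≠ 0 ∧ 0 < dRank d t.2).card := by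
  classical
  rcases Nat.eq_zero_or_pos m with hm | hm
  · subst hm
    have hn : n = 0 := by
      by_contra hn
      have hne : (⟨0, by omega⟩ : Fin (n + 1)) ≠ ⟨1, by omega⟩ := by simp
      exact hne (hinj (Prod.ext (Subsingleton.elim _ _) (funext fun i => i.elim0)))
    subst hn
    simp
  haveI : Nonempty (Fin m) := ⟨⟨0, hm⟩⟩
  set S := univ.filter fun k : Fin n => (p k.castSucc).1 = (p k.succ).1 with hS
  have hdiff : ∀ k ∈ S, ∃ i, (p k.castSucc).2 i ≠ (p k.succ).2 i := by
    intro k hk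
    rw [hS, mem_filter] at hk
    by_contra h
    push Not at h
    exact (k.castSucc_lt_succ).ne (hinj (Prod.ext hk.2 (funext h)))
  choose! pos hpos using hdiff
  let f : Fin n → (Fin m × Fin m) × Fin K :=
    fun k => (((p k.succ).1 (pos k), pos k), (p k.succ).2 (pos k))
  have hstrict : ∀ k ∈ S, dRank d ((p k.castSucc).2 (pos k)) < dRank d ((p k.succ).2 (pos k)) := by
    intro k hk
    have hk' := hk
    rw [hS, mem_filter] at hk'
    have hu : IsDominant d v ε (θ k.castSucc) ((p k.castSucc).1, (p k.castSucc).2) := hdom _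
    have hw : IsDominant d v ε (θ k.succ) ((p k.succ).1, (p k.succ).2) := hdom _
    exact dRank_lt_of_lt d (d_lt_of_dominant_entry d v ε (hθ k.castSucc_lt_succ) _ _ _ _ hu hw (pos k)
      (by rw [hk'.2]) (hpos k hk))
  have hmaps : ∀ k ∈ S,
      f k ∈ (univ.filter fun t : (Fin m × Fin m) × Fin K => ε t.1.1 t.1.2 t.2 ≠ 0 ∧ 0 < dRank d t.2) := by
    intro k hk
    simp only [f, mem_filter, mem_univ, true_and]
    exact ⟨present_of_termSign_ne_zero ε (p k.succ) (hdom k.succ).1 (pos k),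
      lt_of_le_of_lt (Nat.zero_le _) (hstrict k hk)⟩
  have hinjOn : Set.InjOn f S := by
    intro k₁ hk₁ k₂ hk₂ hf
    have hk₁' := hk₁
    have hk₂' := hk₂
    rw [mem_coe, hS, mem_filter] at hk₁' hk₂'
    simp only [f, Prod.mk.injEq] at hf
    obtain ⟨⟨hrow, hposEq⟩, hcls⟩ := hf
    have hrank : dRank d ((p k₁.succ).2 (pos k₁)) = dRank d ((p k₂.succ).2 (pos k₂)) := by rw [hcls]
    by_contra hne
    rcases lt_or_gt_of_ne hne with hlt | hlt
    · have huw : (k₁.succ : Fin (n + 1)) ≤ k₂.castSucc := by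
        rw [Fin.le_iff_val_le_val, Fin.val_succ, Fin.val_castSucc]; exact hlt
      have hσ' : (p k₁.succ).1 (pos k₂) = (p k₂.castSucc).1 (pos k₂) := by
        have h' := hrow
        rw [hposEq] at h'
        rw [hk₂'.2]
        exact h'
      have hle := dRank_le_of_chain_entry d v ε θ p hθ hdom huw (pos k₂) hσ'
      have hlt' := hstrict k₂ hk₂
      rw [hposEq] at hrank
      omega
    · have huw : (k₂.succ : Fin (n + 1)) ≤ k₁.castSucc := by
        rw [Fin.le_iff_val_le_val, Fin.val_succ, Fin.val_castSucc]; exact hlt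
      have hσ' : (p k₂.succ).1 (pos k₁) = (p k₁.castSucc).1 (pos k₁) := by
        have h' := hrow
        rw [← hposEq] at h'
        rw [hk₁'.2]
        exact h'.symm
      have hle := dRank_le_of_chain_entry d v ε θ p hθ hdom huw (pos k₁) hσ'
      have hlt' := hstrict k₁ hk₁
      rw [← hposEq] at hrank
      omega
  exact card_le_card_of_injOn f hmaps hinjOn

/-- the present (entry, class) pairs of positive rank number at most `#{present entries} · (K − 1)`. [folklore] -/
theorem card_presentClasses_le (d : Fin K → ℕ) (ε : Fin m → Fin m → Fin K → ℤ) :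
    (univ.filter fun t : (Fin m × Fin m) × Fin K => ε t.1.1 t.1.2 t.2 ≠ 0 ∧ 0 < dRank d t.2).card ≤
      (univ.filter fun ai : Fin m × Fin m => ∃ l, ε ai.1 ai.2 l ≠ 0).card * (K - 1) := by
  classical
  -- inject into `{present entries} ×ˢ Icc 1 (K−1)` by `(a, i, l) ↦ ((a, i), dRank d l)`?  Not injective in `l` when `d` has ties;
  -- instead bound fiberwise: for a fixed entry the classes of positive rank are at most `K − 1` (the class of rank `0` is excluded).
  have hsub : (univ.filter fun t : (Fin m × Fin m) × Fin K => ε t.1.1 t.1.2 t.2 ≠ 0 ∧ 0 < dRank d t.2) ⊆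
      (univ.filter fun ai : Fin m × Fin m => ∃ l, ε ai.1 ai.2 l ≠ 0) ×ˢ
        (univ.filter fun l : Fin K => 0 < dRank d l) := by
    intro t ht
    simp only [mem_filter, mem_univ, true_and, mem_product] at ht ⊢
    exact ⟨⟨t.2, ht.1⟩, ht.2⟩
  refine (card_le_card hsub).trans ?_
  rw [card_product]
  refine Nat.mul_le_mul_left _ ?_
  -- classes of positive rank: all but at least one class of minimal exponent (if `K ≥ 1`)
  rcases Nat.eq_zero_or_pos K with hK | hK
  · subst hK; simp
  · -- a class of minimal `d`-value has rank `0`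
    obtain ⟨l₀, -, hl₀⟩ := exists_min_image (univ : Finset (Fin K)) d ⟨⟨0, hK⟩, mem_univ _⟩
    have h0 : dRank d l₀ = 0 := by
      unfold dRank
      rw [card_eq_zero, filter_eq_empty_iff]
      intro l' _
      exact not_lt.mpr (hl₀ l' (mem_univ _))
    have hss : (univ.filter fun l : Fin K => 0 < dRank d l) ⊆ univ.erase l₀ := by
      intro l hl
      rw [mem_filter] at hl
      rw [mem_erase]
      exact ⟨fun h => by rw [h, h0] at hl; exact lt_irrefl _ hl.2, mem_univ _⟩
    calc (univ.filter fun l : Fin K => 0 < dRank d l).card ≤ (univ.erase l₀).card := card_le_card hss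
      _ = K - 1 := by rw [card_erase_of_mem (mem_univ _), card_univ, Fintype.card_fin]

/-- **Same-permutation steps ≤ `#{present entries} · (K − 1)`.** [folklore] -/
theorem card_samePerm_steps_le_card_support (d : Fin K → ℕ) (v ε : Fin m → Fin m → Fin K → ℤ) (n : ℕ)
    (θ : Fin (n + 1) → ℤ) (p : Fin (n + 1) → Equiv.Perm (Fin m) × (Fin m → Fin K)) (hθ : StrictMono θ)
    (hdom : ∀ k, IsDominant d v ε (θ k) (p k)) (hinj : Function.Injective p) :
    (univ.filter fun k : Fin n => (p k.castSucc).1 = (p k.succ).1).card ≤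
      (univ.filter fun ai : Fin m × Fin m => ∃ l, ε ai.1 ai.2 l ≠ 0).card * (K - 1) :=
  (card_samePerm_steps_le_card_presentClasses d v ε n θ p hθ hdom hinj).trans (card_presentClasses_le d ε)

/-- **Alternations ≤ permutation changes + `#{present entries}·(K−1)`.**  For every design and every dominant sign-alternating chain
(the hypothesis list of `TropRootLawAt`), `n ≤ #{k : σₖ₊₁ ≠ σₖ} + #{present entries}·(K−1)`. [folklore] -/
theorem le_permChanges_add_support (d : Fin K → ℕ) (v ε : Fin m → Fin m → Fin K → ℤ) (n : ℕ)
    (θ : Fin (n + 1) → ℤ) (p : Fin (n + 1) → Equiv.Perm (Fin m) × (Fin m → Fin K)) (hθ : StrictMono θ)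
    (hdom : ∀ k, IsDominant d v ε (θ k) (p k))
    (halt : ∀ k : Fin n, termSign ε (p k.castSucc) * termSign ε (p k.succ) < 0) :
    n ≤ (univ.filter fun k : Fin n => (p k.castSucc).1 ≠ (p k.succ).1).card +
      (univ.filter fun ai : Fin m × Fin m => ∃ l, ε ai.1 ai.2 l ≠ 0).card * (K - 1) := by
  classical
  have hinj : Function.Injective p := stub_dominantInjective m K d v ε n θ p hθ hdom halt
  have h1 := card_samePerm_steps_le_card_support d v ε n θ p hθ hdom hinj
  have h2 := card_filter_add_card_filter_not
    (s := (univ : Finset (Fin n))) (fun k : Fin n => (p k.castSucc).1 = (p k.succ).1)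
  rw [card_univ, Fintype.card_fin] at h2
  have h3 : (univ.filter fun k : Fin n => (p k.castSucc).1 ≠ (p k.succ).1)
      = univ.filter fun k : Fin n => ¬ (p k.castSucc).1 = (p k.succ).1 := rfl
  rw [h3]
  omega

/-! ### Two-sided banded supports -/

/-- the entries of a two-sided band `|a − i| ≤ B` in an `m × m` array number at most `(2B+1)·m`
(inject `(a, i) ↦ (i, a + B − i)` into `Fin m × Fin (2B+1)`). [folklore] -/
theorem card_band_le (m B : ℕ) :
    (univ.filter fun ai : Fin m × Fin m => (ai.1 : ℕ) ≤ ai.2 + B ∧ (ai.2 : ℕ) ≤ ai.1 + B).card ≤ (2 * B + 1) * m := by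
  classical
  let f : Fin m × Fin m → Fin m × Fin (2 * B + 1) :=
    fun ai => (ai.2, ⟨(ai.1 + B - ai.2) % (2 * B + 1), Nat.mod_lt _ (by omega)⟩)
  have hinj : Set.InjOn f ↑(univ.filter fun ai : Fin m × Fin m => (ai.1 : ℕ) ≤ ai.2 + B ∧ (ai.2 : ℕ) ≤ ai.1 + B) := by
    intro x hx y hy hxy
    rw [mem_coe, mem_filter] at hx hy
    simp only [f, Prod.mk.injEq, Fin.mk.injEq] at hxy
    obtain ⟨h2, h1⟩ := hxy
    have hx' : (x.1 + B - x.2 : ℕ) % (2 * B + 1) = x.1 + B - x.2 := Nat.mod_eq_of_lt (by omega)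
    have hy' : (y.1 + B - y.2 : ℕ) % (2 * B + 1) = y.1 + B - y.2 := Nat.mod_eq_of_lt (by omega)
    rw [hx', hy'] at h1
    have h2' : (x.2 : ℕ) = y.2 := by rw [h2]
    refine Prod.ext (Fin.ext ?_) h2
    omega
  have h := card_le_card_of_injOn f (fun _ _ => mem_univ _) hinj
  rwa [card_univ, Fintype.card_prod, Fintype.card_fin, Fintype.card_fin, mul_comm] at h

/-- **Banded designs: class switches are `O(B·m·K)`.**  If no class is present outside the two-sided band `|a − i| ≤ B`, every dominant
sign-alternating chain has `n ≤ #{k : σₖ₊₁ ≠ σₖ} + (2B+1)·m·(K−1)` — in a band, everything beyond `O(B·m·K)` terms is PERMUTATION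
changes (the «carrier lemma» of the K = 4 digest: if each maximal run of constant top-class count keeps its permutation, the chain has at
most `(2B+1)·m·(K−1) + #runs` terms). [folklore] -/
theorem le_permChanges_add_banded (d : Fin K → ℕ) (v ε : Fin m → Fin m → Fin K → ℤ) (B : ℕ)
    (hband : ∀ a i l, ε a i l ≠ 0 → (a : ℕ) ≤ i + B ∧ (i : ℕ) ≤ a + B) (n : ℕ)
    (θ : Fin (n + 1) → ℤ) (p : Fin (n + 1) → Equiv.Perm (Fin m) × (Fin m → Fin K)) (hθ : StrictMono θ)
    (hdom : ∀ k, IsDominant d v ε (θ k) (p k))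
    (halt : ∀ k : Fin n, termSign ε (p k.castSucc) * termSign ε (p k.succ) < 0) :
    n ≤ (univ.filter fun k : Fin n => (p k.castSucc).1 ≠ (p k.succ).1).card + (2 * B + 1) * m * (K - 1) := by
  classical
  have h := le_permChanges_add_support d v ε n θ p hθ hdom halt
  have hsub : (univ.filter fun ai : Fin m × Fin m => ∃ l, ε ai.1 ai.2 l ≠ 0) ⊆
      (univ.filter fun ai : Fin m × Fin m => (ai.1 : ℕ) ≤ ai.2 + B ∧ (ai.2 : ℕ) ≤ ai.1 + B) := by
    intro ai hai
    rw [mem_filter] at hai ⊢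
    obtain ⟨l, hl⟩ := hai.2
    exact ⟨hai.1, hband ai.1 ai.2 l hl⟩
  have hc := (card_le_card hsub).trans (card_band_le m B)
  have := Nat.mul_le_mul_right (K - 1) hc
  omega

/-- **CARRIER LEMMA** (K = 4 digest §3b).  Label the chain terms by any `g` (e.g. the count of the top class — the «z-block» of a two-digit
chain).  If the permutation changes only when the label does («every block of constant label keeps one permutation = has a carrier»), then in a
design supported in the two-sided band `|a − i| ≤ B` the chain has `n ≤ #{k : g (pₖ₊₁) ≠ g (pₖ)} + (2B+1)·m·(K−1)`: carrier-type banded families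
are `O(B·m·K + #blocks)`. [folklore] -/
theorem le_labelChanges_add_banded {β : Type*} [DecidableEq β] (g : Equiv.Perm (Fin m) × (Fin m → Fin K) → β)
    (d : Fin K → ℕ) (v ε : Fin m → Fin m → Fin K → ℤ) (B : ℕ)
    (hband : ∀ a i l, ε a i l ≠ 0 → (a : ℕ) ≤ i + B ∧ (i : ℕ) ≤ a + B) (n : ℕ)
    (θ : Fin (n + 1) → ℤ) (p : Fin (n + 1) → Equiv.Perm (Fin m) × (Fin m → Fin K)) (hθ : StrictMono θ)
    (hdom : ∀ k, IsDominant d v ε (θ k) (p k))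
    (halt : ∀ k : Fin n, termSign ε (p k.castSucc) * termSign ε (p k.succ) < 0)
    (hcarrier : ∀ k : Fin n, g (p k.castSucc) = g (p k.succ) → (p k.castSucc).1 = (p k.succ).1) :
    n ≤ (univ.filter fun k : Fin n => g (p k.castSucc) ≠ g (p k.succ)).card + (2 * B + 1) * m * (K - 1) := by
  classical
  have h := le_permChanges_add_banded d v ε B hband n θ p hθ hdom halt
  have hsub : (univ.filter fun k : Fin n => (p k.castSucc).1 ≠ (p k.succ).1) ⊆
      (univ.filter fun k : Fin n => g (p k.castSucc) ≠ g (p k.succ)) := by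
    intro k hk
    rw [mem_filter] at hk ⊢
    exact ⟨hk.1, fun hg => hk.2 (hcarrier k hg)⟩
  exact h.trans (Nat.add_le_add_right (card_le_card hsub) _)

end PermChangesSupport

end Summit.ValiantsHypothesis.ValiantsHypothesis.Theorems.LacunarySymmetroidMatrixDescartes.TropicalCensus
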